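import Mathlib
import HarnessLib
import Literature.Probability.Distributions.GaussianWidthStatDist

/-!
# Independent coordinates with Gaussian limits converge JOINTLY to the product Gaussian in `EuclideanSpace ℝ ι`; the limit law of the between-replica sum of squares `Σ_r (Z_r − Z̄)²` has mean `(R−1)v`

HONEST FRAMING: exact (Metropolis-corrected) sampling algorithms for lattice gauge theory;
figures of merit are autocorrelation/cost numbers at stated couplings and volumes; no
continuum-physics claim.

Venture `LatticeQCDFlow` (cell pub-lqcd), topic `Exactness`; FANOUT row 13 (`eng-snf`, GEN-23, replica
pooling).  NEW WORK of the cell (against Mathlib's characteristic functions on the Euclidean space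
`PiLp 2 (ι → ℝ)`, `MeasureTheory.charFun_pi`, and Lévy's continuity theorem
`ProbabilityMeasure.tendsto_iff_tendsto_charFun`; the second Gaussian moment is imported from
`Literature/Probability/Distributions/GaussianWidthStatDist`), not a published result; no definition is
introduced; nothing is cited as a fact (the delete-one-replica jackknife / "many short chains" error bar
and its `χ²_{R−1}` / Student-`t_{R−1}` calibration are NAMED ONLY).

WHY (row 13).  `latflow-snf`'s `estimators.free_energy` reports, along correlated starts, a JACKKNIFE
over `≥ 10` replicas / blocks, i.e. an error bar built from the SPREAD of the `R` replica estimates.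
GEN-23's pooled Γ-method files show the windowed bar is consistent; to say what the spread-based bar
does at FIXED `R` one needs the JOINT limit of the replica vector.  This file is the generic half:
if each coordinate `X_{r,n}` (independent across `r`, product law `⊗_r P_r`) satisfies
`X_{r,n} ⇒ N(0, v_r)`, then the vector `(X_{r,n})_r ⇒ ⊗_r N(0, v_r)` in `EuclideanSpace ℝ ι` (joint
characteristic function = product of the marginal ones, `charFun_pi` on the limit side, Lévy), so every
continuous functional converges; and the limit law of the between-replica sum of squares
`Σ_r (Z_r − Z̄)²`, `Z ~ N(0, v)^{⊗R}`, has mean `(R−1)v` — its normalised version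
`Σ_r (Z_r − Z̄)²/(R(R−1))` has mean `v/R`, the variance of the pooled mean `Z̄`.  The chain instance
(`(√n (ȳ_{r,n} − πf))_r ⇒ N(0, σ²_f)^{⊗R}` from every family of starts, and the RANDOM limit of
`n ŝe²_n`) is `NCMCGeneralSpaceReplicaVectorCLTChains`.

## Content
* **`charFun_pi_map_toLp`** — `φ_{(X_r)_r}(t) = Π_r φ_{X_r}(t_r)` under a product law.
* **`tendstoInDistribution_pi_toLp`** — factors converging to `N(0, v_r)` ⇒ the vector converges to
  `⊗_r N(0, v_r)` in `EuclideanSpace ℝ ι`; `tendstoInDistribution_pi_comp_of_continuous`;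
  `continuous_sumSqDev`.
* `integral_mul_pi_gaussianReal` (`∫ z_r z_s = v·1{r=s}`), **`integral_sumSqDev_pi_gaussianReal`**
  (`∫ Σ_r (z_r − z̄)² = (R−1)v`), `integral_spreadVar_pi_gaussianReal` (`= v/R`, `R ≥ 2`).

NOT CLAIMED: the identification of the law of `Σ_r (Z_r − Z̄)²` with `v χ²_{R−1}`; anything numerical.
-/

namespace Summit.Ventures.LatticeQCDFlow.Exactness.GeneralNCMC

open MeasureTheory ProbabilityTheory Set Filter Finset Complex WithLp
open scoped ENNReal NNReal Topology RealInnerProductSpace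

/-! ## §1 The replica vector under a product law -/

section Vector

variable {ι : Type*} [Fintype ι] {Ω : ι → Type*} [∀ r, MeasurableSpace (Ω r)]
  {P : (r : ι) → Measure (Ω r)} [∀ r, IsProbabilityMeasure (P r)]

/-- **`φ_{(X_r)_r}(t) = Π_r φ_{X_r}(t_r)` under a product law** (the replica VECTOR, valued in
`EuclideanSpace ℝ ι`). -/
theorem charFun_pi_map_toLp {X : (r : ι) → Ω r → ℝ} (hX : ∀ r, Measurable (X r))
    (t : PiLp 2 (fun _ : ι => ℝ)) :
    charFun ((Measure.pi P).map fun ω : (r : ι) → Ω r => toLp 2 (fun r => X r (ω r))) t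
      = ∏ r, charFun ((P r).map (X r)) (t r) := by
  have hV : Measurable fun (ω : (r : ι) → Ω r) (r : ι) => X r (ω r) :=
    measurable_pi_lambda _ fun r => (hX r).comp (measurable_pi_apply r)
  have hm : Measurable fun ω : (r : ι) → Ω r => toLp 2 (fun r => X r (ω r)) :=
    (MeasurableEquiv.toLp 2 (ι → ℝ)).measurable.comp hV
  rw [charFun_apply, integral_map hm.aemeasurable (by fun_prop)]
  have h2 : ∀ r, charFun ((P r).map (X r)) (t r)
      = ∫ ω, Complex.exp ((⟪X r ω, t r⟫ : ℂ) * I) ∂(P r) := by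
    intro r
    rw [charFun_apply, integral_map (hX r).aemeasurable (by fun_prop)]
  simp only [h2]
  rw [← integral_fintype_prod_eq_prod
    (fun r (ω : Ω r) => Complex.exp ((⟪X r ω, t r⟫ : ℂ) * I))]
  refine integral_congr_ae (Eventually.of_forall fun ω => ?_)
  dsimp only
  rw [PiLp.inner_apply, ← Complex.exp_sum]
  congr 1
  push_cast
  rw [Finset.sum_mul]

/-- **INDEPENDENT GAUSSIAN LIMITS, JOINTLY**: if every `X r n ⇒ N(0, v r)` under `P r`, then under the
product law the replica vector `(X r n (ω r))_r` — as an element of `EuclideanSpace ℝ ι` — converges in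
distribution to the product Gaussian `⊗_r N(0, v r)` (canonical variable `toLp 2` on
`(ι → ℝ, ⊗_r N(0, v r))`). -/
theorem tendstoInDistribution_pi_toLp {X : (r : ι) → ℕ → Ω r → ℝ} (hX : ∀ r n, Measurable (X r n))
    {v : ι → ℝ≥0}
    (h : ∀ r, TendstoInDistribution (X r) atTop id (fun _ => P r) (gaussianReal 0 (v r))) :
    TendstoInDistribution (fun (n : ℕ) (ω : (r : ι) → Ω r) => toLp 2 (fun r => X r n (ω r))) atTop
      (toLp 2) (fun _ => Measure.pi P) (Measure.pi fun r => gaussianReal 0 (v r)) := by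
  have hm : ∀ n, Measurable fun ω : (r : ι) → Ω r => toLp 2 (fun r => X r n (ω r)) := fun n =>
    (MeasurableEquiv.toLp 2 (ι → ℝ)).measurable.comp
      (measurable_pi_lambda _ fun r => (hX r n).comp (measurable_pi_apply r))
  refine ⟨fun n => (hm n).aemeasurable, (MeasurableEquiv.toLp 2 (ι → ℝ)).measurable.aemeasurable, ?_⟩
  refine ProbabilityMeasure.tendsto_iff_tendsto_charFun.2 fun t => ?_
  have hL : ∀ n : ℕ, charFun ((Measure.pi P).map fun ω : (r : ι) → Ω r =>
      toLp 2 (fun r => X r n (ω r))) t = ∏ r, charFun ((P r).map (X r n)) (t r) := fun n =>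
    charFun_pi_map_toLp (fun r => hX r n) t
  have hR : charFun ((Measure.pi fun r => gaussianReal 0 (v r)).map (toLp 2)) t
      = ∏ r, charFun (gaussianReal 0 (v r)) (t r) := charFun_pi t
  simp only [ProbabilityMeasure.coe_mk, hL, hR]
  refine tendsto_finsetProd _ fun r _ => ?_
  have hr := (ProbabilityMeasure.tendsto_iff_tendsto_charFun.1 (h r).tendsto) (t r)
  simp only [ProbabilityMeasure.coe_mk, Measure.map_id] at hr
  exact hr

/-- **Continuous functionals of the replica vector** converge in distribution to the functional of the
product Gaussian. -/
theorem tendstoInDistribution_pi_comp_of_continuous {X : (r : ι) → ℕ → Ω r → ℝ}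
    (hX : ∀ r n, Measurable (X r n)) {v : ι → ℝ≥0}
    (h : ∀ r, TendstoInDistribution (X r) atTop id (fun _ => P r) (gaussianReal 0 (v r)))
    {g : PiLp 2 (fun _ : ι => ℝ) → ℝ} (hg : Continuous g) :
    TendstoInDistribution (fun (n : ℕ) (ω : (r : ι) → Ω r) => g (toLp 2 (fun r => X r n (ω r))))
      atTop (fun z => g (toLp 2 z)) (fun _ => Measure.pi P) (Measure.pi fun r => gaussianReal 0 (v r)) :=
  (tendstoInDistribution_pi_toLp hX h).continuous_comp hg

/-- The between-replica sum of squares is a continuous functional on `EuclideanSpace ℝ ι`. -/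
theorem continuous_sumSqDev :
    Continuous fun x : PiLp 2 (fun _ : ι => ℝ) => ∑ r, (x r - (∑ r', x r') / Fintype.card ι) ^ 2 := by
  have hc : ∀ r : ι, Continuous fun x : PiLp 2 (fun _ : ι => ℝ) => x r := fun r =>
    (continuous_apply r).comp (PiLp.continuous_ofLp 2 _)
  fun_prop

end Vector

/-! ## §2 Moments of the limit law -/

section Mean

variable {ι : Type*} [Fintype ι]

/-- Mixed second moments of the product Gaussian: `∫ z_r z_s d(⊗ N(0, v)) = v · 1{r = s}`. -/
theorem integral_mul_pi_gaussianReal [DecidableEq ι] (v : ℝ≥0) (r s : ι) :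
    ∫ z, z r * z s ∂(Measure.pi fun _ : ι => gaussianReal 0 v) = if r = s then (v : ℝ) else 0 := by
  split_ifs with hrs
  · subst hrs
    have hmap := (measurePreserving_eval (fun _ : ι => gaussianReal 0 v) r).map_eq
    have h := integral_map (μ := Measure.pi fun _ : ι => gaussianReal 0 v)
      (measurable_pi_apply r).aemeasurable (f := fun x : ℝ => x ^ 2) (by fun_prop)
    rw [hmap, Literature.Probability.Distributions.integral_sq_gaussianReal_zero] at h
    rw [h]
    exact integral_congr_ae (Eventually.of_forall fun z => by simp [sq])
  · -- `∏_i f_i(z_i)` with `f_r = f_s = id`, all other factors `1`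
    have key := integral_fintype_prod_eq_prod (μ := fun _ : ι => gaussianReal 0 v)
      (fun (i : ι) (x : ℝ) => if i = r ∨ i = s then x else 1)
    have hprod : ∀ z : ι → ℝ, (∏ i, (if i = r ∨ i = s then z i else 1)) = z r * z s := by
      intro z
      rw [Finset.prod_ite, Finset.prod_const_one, mul_one]
      have hf : Finset.univ.filter (fun i => i = r ∨ i = s) = {r, s} := by
        ext i; simp
      rw [hf, Finset.prod_pair hrs]
    simp_rw [hprod] at key
    rw [key]
    exact Finset.prod_eq_zero (Finset.mem_univ r) (by simp [integral_id_gaussianReal])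

/-- **The mean of the limit law of the between-replica sum of squares**:
`∫ Σ_r (z_r − z̄)² d(⊗_r N(0, v)) = (R − 1) v`, `R = card ι ≥ 1`. -/
theorem integral_sumSqDev_pi_gaussianReal [Nonempty ι] (v : ℝ≥0) :
    ∫ z, (∑ r, (z r - (∑ r', z r') / Fintype.card ι) ^ 2) ∂(Measure.pi fun _ : ι => gaussianReal 0 v)
      = ((Fintype.card ι : ℝ) - 1) * v := by
  classical
  have hR : (Fintype.card ι : ℝ) ≠ 0 := by exact_mod_cast (Fintype.card_ne_zero : Fintype.card ι ≠ 0)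
  have hmem : ∀ r : ι, MemLp (fun z : ι → ℝ => z r) 2 (Measure.pi fun _ : ι => gaussianReal 0 v) :=
    fun r => (memLp_id_gaussianReal (μ := 0) (v := v) 2).comp_measurePreserving
      (measurePreserving_eval (fun _ : ι => gaussianReal 0 v) r)
  have hint : ∀ r s : ι, Integrable (fun z : ι → ℝ => z r * z s)
      (Measure.pi fun _ : ι => gaussianReal 0 v) := fun r s => (hmem r).integrable_mul (hmem s)
  -- the algebraic identity `Σ_r (z_r − z̄)² = Σ_r z_r z_r − (Σ_r Σ_s z_r z_s)/R`
  have hId : ∀ z : ι → ℝ, ∑ r, (z r - (∑ r', z r') / Fintype.card ι) ^ 2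
      = ∑ r, z r * z r - (∑ r, ∑ s, z r * z s) / Fintype.card ι := by
    intro z
    have hSS : ∑ r, ∑ s, z r * z s = (∑ r, z r) * (∑ s, z s) := by
      rw [Finset.sum_mul_sum]
    rw [hSS]
    have hexp : ∀ r, (z r - (∑ r', z r') / Fintype.card ι) ^ 2
        = z r * z r - 2 * ((∑ r', z r') / Fintype.card ι) * z r
          + ((∑ r', z r') / Fintype.card ι) ^ 2 := fun r => by ring
    simp only [hexp, Finset.sum_add_distrib, Finset.sum_sub_distrib, ← Finset.mul_sum, Finset.sum_const,
      Finset.card_univ, nsmul_eq_mul]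
    field_simp
    ring
  have hinner : ∀ r : ι, ∫ z, ∑ s, z r * z s ∂(Measure.pi fun _ : ι => gaussianReal 0 v)
      = ∑ s, ∫ z, z r * z s ∂(Measure.pi fun _ : ι => gaussianReal 0 v) := fun r =>
    integral_finsetSum _ (fun s _ => hint r s)
  simp_rw [hId]
  rw [integral_sub (integrable_finsetSum _ fun r _ => hint r r)
    ((integrable_finsetSum _ fun r _ => integrable_finsetSum _ fun s _ => hint r s).div_const _),
    integral_finsetSum _ (fun r _ => hint r r), integral_div,
    integral_finsetSum _ (fun r _ => integrable_finsetSum _ fun s _ => hint r s)]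
  simp_rw [hinner, integral_mul_pi_gaussianReal v]
  simp only [Finset.sum_ite_eq, Finset.mem_univ, if_true, Finset.sum_const, Finset.card_univ,
    nsmul_eq_mul]
  field_simp

/-- … so, for `R ≥ 2`, the limit law of `n · ŝe²_n = n Σ_r (ȳ_r − ȳ̄)²/(R(R−1))` has mean `v/R` — the
asymptotic variance of the pooled mean: the replica-spread bar is calibrated ON AVERAGE, random at
fixed `R`. -/
theorem integral_spreadVar_pi_gaussianReal [Nontrivial ι] (v : ℝ≥0) :
    ∫ z, (∑ r, (z r - (∑ r', z r') / Fintype.card ι) ^ 2)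
        / ((Fintype.card ι : ℝ) * (Fintype.card ι - 1)) ∂(Measure.pi fun _ : ι => gaussianReal 0 v)
      = (v : ℝ) / Fintype.card ι := by
  rw [integral_div, integral_sumSqDev_pi_gaussianReal]
  have hR : (Fintype.card ι : ℝ) ≠ 0 := by exact_mod_cast (Fintype.card_ne_zero : Fintype.card ι ≠ 0)
  have h1 : (Fintype.card ι : ℝ) - 1 ≠ 0 := by
    have : (1 : ℝ) < Fintype.card ι := by exact_mod_cast Fintype.one_lt_card
    linarith
  field_simp

end Mean

end Summit.Ventures.LatticeQCDFlow.Exactness.GeneralNCMC
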